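/-
Copyright: statement-level skeleton of a published paper (lit-balaban cell, Phase-2 proof seat p13, gen 2). No proof
claims beyond what the kernel checks below.
-/
import Literature.MathematicalPhysics.QuantumFieldTheory.BalabanImbrieJaffe1984to88.BIJ88Sect2Statements
import Literature.MathematicalPhysics.QuantumFieldTheory.Balaban1983to89.B4RandomWalk213

/-!
# `BalabanImbrieJaffe1984to88.BIJ88RandomWalk242` — T. Bałaban, J. Imbrie, A. Jaffe, *Effective action and cluster
properties of the abelian Higgs model*, Commun. Math. Phys. **114** (1988) 257–315 [BalabanImbrieJaffe1988]: Sect. 2,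
**(2.42)–(2.45)** p. 264 and **(2.46)** (support clause), **(2.48)** p. 264–265 — the random walk expansion
`C^{(k)}_Λ(u) = Σ_ω C_ω` of the single-scale scalar propagator, its localized part `C^{(k)}_{Λ,loc} = Σ′_ω C_ω`, the
parts `C^{(k)}_{Λ,X} = Σ^X_ω C_ω` indexed by connected unions `X` of `r(e_k)`-cubes, and the resummation identity
`C^{(k)}_Λ = C^{(k)}_{Λ,loc} + Σ_X C^{(k)}_{Λ,X}` PROVED as a partition of an unconditionally convergent walk sum; the
expansion itself (*"a random walk expansion as in [6]"*, [6] = [Balaban1983RegularityDecay]) PROVED in the abstract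
setting of the tree module `Balaban1983to89.B4RandomWalk213`.

statement-level skeleton of published theorems with citation tags; proofs where landed; nothing here is a claim about the Yang–Mills mass gap

PDF held: `paper:balaban1988-cmp114-bij-abelian-higgs-effective-action` (journal page = PDF page + 256); pp. 264–265 read
from the text layer (`lit read … --pages 8-9`) against the owner's verbatim cells in `HOME/lit-balaban-r18/ROWS-C2.md`.

CITATION HEADER (lean-in-tree rule).  Part of the lit-balaban TYPED SKELETON (HOME `run/shared/lean/pub/lit-balaban/`):
WHAT IS REPRODUCED = rows **C2.Eq2.42**, **C2.Eq2.43**, **C2.Eq2.44** (all `absent`: *"walk combinatorics = B4's; the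
resummed form (2.45) is typed"*) and **C2.Eq2.48** (`absent`, naming convention) of `HOME/lit-balaban-r18/ROWS-C2.md`,
plus PROOFS of the typed rows **C2.Eq2.45** (`BIJ88Sect2Statements.Eq245`, instantiated) and of the support clause of
**C2.Eq2.46** (first conjunct of `BIJ88Sect2Statements.Ineq246`); unit `lit-balaban-p13` (gen 2), owner reading R1 of
`lit-balaban-r18` (2026-08-21T01:19Z, see READING NOTE), referee ref-5.

THE PRINTED TEXT (p. 264 [PDF 8]; the displays (2.42)–(2.44), (2.46), (2.48) are quoted verbatim at their declarations
below).  *"We define C^{(k)}_Λ(u) = [(Δ_{k,loc}(u) + aL^{−2}Q(u)^*Q(u))|_Λ]^{−1}. (2.40) This is of course a nonlocal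
operator, but by (2.38), C^{(k)}_Λ(u)^{−1} is bounded below and a random walk expansion as in [6] can be used to prove
that |C^{(k)}_Λ(u; x₁, x₂)| ≦ ce^{−c|x₁−x₂|}. (2.41) We shall actually use a convenient resummation of this expansion.
… Then we define C^{(k)}_Λ(u) = C^{(k)}_{Λ,loc}(u) + Σ_X C^{(k)}_{Λ,X}(u), (2.45) and the convergence and locality
properties of the random walk expansion imply the following facts about these operators. The local part
C^{(k)}_{Λ,loc}(u; x₁, x₂) depends only on u in an O(r(e_k)) neighborhood of x₁, x₂; it vanishes for |x₁ − x₂| >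
½r(e_k) and is bounded as in (2.41)."* (v1.1: «½r(e_k)» per the page image — owner reading R2, r18 g2; the OCR text
layer reads «2r(e_k)», quoted so in v1)  p. 265 [PDF 9]: *"Here and elsewhere, |X| refers to the number of r(e_k)-cubes
in X, not the volume of X."*  [6] = T. Bałaban, *Regularity and decay of lattice Green's functions*, CMP **89** (1983):
(2.13) p. 577 *"G_k(Ω,A) = Σ_ω h_{ω₀}G_k(□_{ω₀},Ã_{ω₀})h_{ω₀}K_{ω₁}G_k(□_{ω₁},Ã_{ω₁})h_{ω₁} …"* over *"paths ω = {ω₀, ω₁,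
…, ω_n}"* (typed in `B4RandomWalk213`: `bprod`, `IsWalk`, `walks`, `order_term_eq_sum_tuples`, …).

THE TYPING (carriers ABSTRACT, as in `BIJ88Sect2Statements`).  Labels `ι` = the points `j` of the `M`-lattice (the
`M`-cubes `□_j` of [6]), a finite type; a WALK `ω = (ω₀; ω₁, …, ω_n)` = `Walk ι` (start, length, steps) — ALL tuples
(the nearest-neighbour condition of [6] is `Walk.IsNN`; the terms of [6] vanish off such walks by locality,
`B4RandomWalk213.mul_bprod_eq_zero_of_not_isWalk`, so the sum over all tuples IS the printed sum); sites `x : α`; walk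
terms = kernels `Cw ω : α → α → ℝ`; `r(e_k)`-cubes `κ` (finite type), `cubeOf : ι → κ` (the cube of a label), `cadj`
(adjacent cubes), `ldist j x` (label-to-site distance), `ρ = ¼r(e_k)`.  (2.42) = `Eq242 C Cw`: for all `x₁ x₂`,
`HasSum (ω ↦ C_ω(x₁,x₂)) (C(x₁,x₂))` — the infinite walk sum converges UNCONDITIONALLY entrywise (*"the convergence …
properties of the random walk expansion"*).  (2.43) = `cLoc`: the sub-sum over `Near` := every visited label lies
within `ρ` of `x₁` AND of `x₂`.  (2.44) = `cX … X`: the sub-sum over walks NOT near with `region ω = X` — READING NOTE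
(owner ruling R1, r18 gen 2, 2026-08-21T01:19Z, binding for the C2 fold): `X` IS DETERMINED BY THE WALK, `X⁰(ω) :=
cubesMet ω` (cubes met by ω), `X(ω) := region ω := closure cadj X⁰(ω)` (`X⁰` plus its boundary layer); then ω stays
in `X⁰`, meets every cube of `X⁰`, and `X⁰ ⊆ interior X` (`cubesMet_subset_interior`) as printed, whereas the LITERAL
"X any connected union, X⁰ = its interior cubes" does not partition the walks (a one-cube `X⁰` is the interior of
several `X`; a walk around a hole is in no class) and (2.45) would fail (HOME/GAPS.md G-C2-p13-1).  Index type of (2.45):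
`ξ = Finset κ` (`cX X = 0` unless `X = region ω` for a contributing ω).  (2.45) = `BIJ88Sect2Statements.Eq245 C (cLoc …)
(cX …)` PROVED from `Eq242` alone (`eq245_of_eq242`, fiberwise resummation).  (2.46) support clause = `cX_support`
(`memX x X` := *x lies in a block `□_j` whose cube closure is inside `X`*), from END-POINT LOCALITY of the terms
(`C_ω(x₁,x₂) ≠ 0 ⇒ x₁ ∈ □_{ω₀}, x₂ ∈ □_{ω_n}`: the outer `h_{ω₀}`, `h_{ω_n}` of [6] (2.13)); *"vanishes for |x₁ − x₂| >
½r(e_k)"* = `cLoc_eq_zero_of_far` (exactly: `> 2ρ = ½r(e_k)`); (2.48) = `cLoc_congr`.  (2.42) PROVED in the setting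
of [6]: `hasSum_walkTerm` — complete normed ring, LOCAL factors (`a_jb_{j′} = 0 = b_jb_{j′}` unless `j ~ j′`),
`‖a_j‖ ≤ α`, `‖b_j‖ ≤ β`, out-degree `≤ D`, `Dβ < 1`, `‖R‖ < 1`, `G(1 − R) = G₀` (`G₀ = Σa_j`, `R = Σb_j`) ⇒ `HasSum
(ω ↦ a_{ω₀}b_{ω₁}⋯b_{ω_n}) G` over ALL walks; entrywise `eq242_of_walkTerm` (continuous additive evaluations).

NOT HERE (deliberately).  The bound half of (2.46) and (2.47) (walk-length geometry; companion file offered to seat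
p36 gen 2), connectedness of `region ω`, the identification of the abstract factors with the operators of (2.40)
(`BIJ88Sect2Statements.Eq240`, abstract ring), the gauge-covariance remark of p. 265.  The only `Prop`-valued
definition is the row statement `Eq242`, DISCHARGED in the [6]-model by `eq242_of_walkTerm`.
-/

-- v1.1 (same seat): APPEND-ONLY §8 (connectedness of the region X(ω) of a nearest-neighbour walk; only connected X
-- carry C_{Λ,X}) + docstring-only R2 fix («½r(e_k)»); no v1 declaration changed (signatures frozen for p36 g2's files).

namespace Literature.MathematicalPhysics.QuantumFieldTheory.BalabanImbrieJaffe1984to88.BIJ88RandomWalk242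

open scoped BigOperators
open Finset
open Literature.MathematicalPhysics.QuantumFieldTheory.Balaban1983to89.B4RandomWalk213

/-! ## §1 Walks `ω = (ω₀; ω₁, …, ω_n)` on the label set `ι` -/

/-- **(2.42)** p. 264 [PDF 8], the carrier: *"where ω is a walk on a lattice of spacing M = O(1)"* — a walk is a start
label `ω₀`, a length `n` and the tuple `(ω₁, …, ω_n)`; all tuples are admitted (the nearest-neighbour condition of [6]
(2.13) is `Walk.IsNN`; non-nearest-neighbour tuples carry the term `0`). [cite: BalabanImbrieJaffe1988, (2.42) p.264] -/
structure Walk (ι : Type*) where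
  /-- `ω₀` -/
  start : ι
  /-- `n`, the number of steps -/
  len : ℕ
  /-- `(ω₁, …, ω_n)` -/
  steps : Fin len → ι

namespace Walk

variable {ι : Type*}

/-- walks are the dependent pairs `(n, (ω₀, (ω₁,…,ω_n)))` (used to sum length by length).
[cite: BalabanImbrieJaffe1988, (2.42) p.264] -/
def equivSigma : Walk ι ≃ Σ n : ℕ, ι × (Fin n → ι) where
  toFun ω := ⟨ω.len, ω.start, ω.steps⟩
  invFun p := ⟨p.2.1, p.1, p.2.2⟩
  left_inv ω := by cases ω; rfl
  right_inv p := by rcases p with ⟨n, i, ys⟩; rfl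

/-- the end-point `ω_n` (`= ω₀` for `n = 0`), [6]'s `lastPt`. [cite: BalabanImbrieJaffe1988, (2.42) p.264] -/
def last (ω : Walk ι) : ι := lastPt ω.start ω.len ω.steps

/-- the nearest-neighbour condition of [6] (2.13) for an adjacency `adj` of labels (`B4RandomWalk213.IsWalk`).
[cite: BalabanImbrieJaffe1988, (2.42) p.264] -/
def IsNN (adj : ι → ι → Prop) (ω : Walk ι) : Prop := IsWalk adj ω.start ω.steps

variable [DecidableEq ι]

/-- the set of labels visited, `{ω₀, ω₁, …, ω_n}`. [cite: BalabanImbrieJaffe1988, (2.42) p.264] -/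
def pts (ω : Walk ι) : Finset ι := insert ω.start (Finset.univ.image ω.steps)

/-- `ω₀` is visited. [cite: BalabanImbrieJaffe1988, (2.42) p.264] -/
theorem start_mem_pts (ω : Walk ι) : ω.start ∈ ω.pts := Finset.mem_insert_self _ _

/-- each `ω_i` is visited. [cite: BalabanImbrieJaffe1988, (2.42) p.264] -/
theorem steps_mem_pts (ω : Walk ι) (k : Fin ω.len) : ω.steps k ∈ ω.pts :=
  Finset.mem_insert_of_mem (Finset.mem_image_of_mem _ (Finset.mem_univ k))

/-- `ω_n` is visited. [cite: BalabanImbrieJaffe1988, (2.42) p.264] -/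
theorem last_mem_pts (ω : Walk ι) : ω.last ∈ ω.pts := by
  rcases ω with ⟨s, n, ys⟩
  cases n with
  | zero => exact Finset.mem_insert_self _ _
  | succ n => exact steps_mem_pts ⟨s, n + 1, ys⟩ (Fin.last n)

end Walk

/-! ## §2 (2.42): the expansion as an unconditionally convergent walk sum, entry by entry -/

section Expansion

variable {ι α : Type*}

/-- **(2.42)** p. 264 [PDF 8], verbatim: *"The basic expansion has the form C^{(k)}_Λ(u) = Σ_ω C_ω, (2.42) where ω is a
walk on a lattice of spacing M = O(1)."* — typed reading: for every pair of sites the walk sum converges unconditionally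
to the kernel entry, `HasSum (ω ↦ C_ω(x₁,x₂)) (C(x₁,x₂))` over ALL walks; walk terms abstract kernels `Cw ω`. Discharged
in the setting of [6] by `eq242_of_walkTerm`. [cite: BalabanImbrieJaffe1988, (2.42) p.264] -/
def Eq242 (C : α → α → ℝ) (Cw : Walk ι → α → α → ℝ) : Prop :=
  ∀ x₁ x₂, HasSum (fun ω => Cw ω x₁ x₂) (C x₁ x₂)

end Expansion

/-! ## §3 (2.43): the localized part `C^{(k)}_{Λ,loc} = Σ′_ω C_ω` -/

section Local

variable {ι α : Type*} [DecidableEq ι]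

/-- the restriction *"only ω remaining within ¼r(e_k) of x₁, x₂ are included"* (p. 264): every visited label lies
within `ρ` (`= ¼r(e_k)`) of `x₁` and within `ρ` of `x₂`, for the label-to-site distance `ldist`.
[cite: BalabanImbrieJaffe1988, (2.43) p.264] -/
def Near (ldist : ι → α → ℝ) (ρ : ℝ) (ω : Walk ι) (x₁ x₂ : α) : Prop :=
  ∀ j ∈ ω.pts, ldist j x₁ ≤ ρ ∧ ldist j x₂ ≤ ρ

/-- **(2.43)** p. 264 [PDF 8], verbatim: *"We define the localized form of C^{(k)}_Λ(u) to be C^{(k)}_{Λ,loc}(u; x₁, x₂)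
= Σ′_ω C_ω(x₁, x₂), (2.43) where the prime indicates that only ω remaining within ¼r(e_k) of x₁, x₂ are included."* —
the sub-sum of the walk expansion over `Near ldist ρ ω x₁ x₂`. [cite: BalabanImbrieJaffe1988, (2.43) p.264] -/
noncomputable def cLoc (ldist : ι → α → ℝ) (ρ : ℝ) (Cw : Walk ι → α → α → ℝ) (x₁ x₂ : α) : ℝ :=
  ∑' ω, {ω : Walk ι | Near ldist ρ ω x₁ x₂}.indicator (fun ω => Cw ω x₁ x₂) ω

/-- p. 264, *"it vanishes for |x₁ − x₂| > ½r(e_k)"* (v1.1: «½», owner reading R2; v1 quoted the OCR «2r(e_k)») — here for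
`dist(x₁,x₂) > 2ρ = ½r(e_k)` (`ρ = ¼r(e_k)`): a walk within
`ρ` of both sites forces `dist(x₁,x₂) ≤ 2ρ` by the triangle inequality through its start label (`htri`).
[cite: BalabanImbrieJaffe1988, (2.43) p.264] -/
theorem cLoc_eq_zero_of_far (ldist : ι → α → ℝ) (ρ : ℝ) (Cw : Walk ι → α → α → ℝ) (sdist : α → α → ℝ)
    (htri : ∀ j x₁ x₂, sdist x₁ x₂ ≤ ldist j x₁ + ldist j x₂) {x₁ x₂ : α} (hfar : 2 * ρ < sdist x₁ x₂) :
    cLoc ldist ρ Cw x₁ x₂ = 0 := by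
  unfold cLoc
  rw [← tsum_zero (β := Walk ι)]
  refine tsum_congr fun ω => Set.indicator_of_notMem (fun hn => ?_) _
  have h := hn ω.start ω.start_mem_pts
  linarith [htri ω.start x₁ x₂, h.1, h.2]

/-- **(2.48)** p. 265 [PDF 9], verbatim: *"neither does C^{(k)}_{Λ,loc}(u; x₁, x₂) depend on Λ if dist({x₁, x₂}, Λ^c) >
½r(e_k). In this case we write it as C^{(k)}_{loc}(u; x₁, x₂) = C^{(k)}_{Λ,loc}(u; x₁, x₂), Λ large enough. (2.48)"* —
typed as the agreement lemma behind the notation: two expansions (for Λ, Λ′) whose walk terms coincide on every walk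
visiting only labels in `P` (locality of the factors of [6]) have the same local part at any `x₁, x₂` whose
`ρ`-neighbourhoods consist of `P`-labels (`ρ + ρ = ½r(e_k)`). [cite: BalabanImbrieJaffe1988, (2.48) p.265] -/
theorem cLoc_congr (ldist : ι → α → ℝ) (ρ : ℝ) {Cw Cw' : Walk ι → α → α → ℝ} (P : ι → Prop)
    (hagree : ∀ ω : Walk ι, (∀ j ∈ ω.pts, P j) → Cw ω = Cw' ω) {x₁ x₂ : α}
    (hP : ∀ j, ldist j x₁ ≤ ρ → ldist j x₂ ≤ ρ → P j) :
    cLoc ldist ρ Cw x₁ x₂ = cLoc ldist ρ Cw' x₁ x₂ := by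
  unfold cLoc
  refine tsum_congr fun ω => ?_
  by_cases hn : Near ldist ρ ω x₁ x₂
  · rw [Set.indicator_of_mem (show ω ∈ {ω : Walk ι | Near ldist ρ ω x₁ x₂} from hn),
      Set.indicator_of_mem (show ω ∈ {ω : Walk ι | Near ldist ρ ω x₁ x₂} from hn),
      hagree ω fun j hj => hP j (hn j hj).1 (hn j hj).2]
  · rw [Set.indicator_of_notMem (show ω ∉ {ω : Walk ι | Near ldist ρ ω x₁ x₂} from hn),
      Set.indicator_of_notMem (show ω ∉ {ω : Walk ι | Near ldist ρ ω x₁ x₂} from hn)]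

end Local

/-! ## §4 (2.44): cube regions of walks and the parts `C^{(k)}_{Λ,X} = Σ^X_ω C_ω` -/

section Regions

variable {ι α κ : Type*} [DecidableEq ι] [Fintype κ] [DecidableEq κ]

/-- `X⁰(ω)`: the `r(e_k)`-cubes met by the walk (reading R1). [cite: BalabanImbrieJaffe1988, (2.44) p.264] -/
def cubesMet (cubeOf : ι → κ) (ω : Walk ι) : Finset κ := ω.pts.image cubeOf

open Classical in
/-- the closure of a cube set: `S` together with every cube adjacent to a cube of `S` (its boundary layer).
[cite: BalabanImbrieJaffe1988, (2.44) p.264] -/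
noncomputable def closure (cadj : κ → κ → Prop) (S : Finset κ) : Finset κ :=
  Finset.univ.filter fun c => c ∈ S ∨ ∃ c' ∈ S, cadj c' c

open Classical in
/-- *"the cubes of X not at the boundary of X"*: cubes of `X` all of whose neighbours belong to `X`.
[cite: BalabanImbrieJaffe1988, (2.44) p.264] -/
noncomputable def interior (cadj : κ → κ → Prop) (X : Finset κ) : Finset κ :=
  X.filter fun c => ∀ c', cadj c c' → c' ∈ X

/-- `X(ω) := X⁰(ω) ∪ boundary layer` (reading R1): the cube region of the walk. [cite: BalabanImbrieJaffe1988, (2.44) p.264] -/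
noncomputable def region (cubeOf : ι → κ) (cadj : κ → κ → Prop) (ω : Walk ι) : Finset κ :=
  closure cadj (cubesMet cubeOf ω)

/-- membership in the closure. [cite: BalabanImbrieJaffe1988, (2.44) p.264] -/
theorem mem_closure {cadj : κ → κ → Prop} {S : Finset κ} {c : κ} :
    c ∈ closure cadj S ↔ c ∈ S ∨ ∃ c' ∈ S, cadj c' c := by
  unfold closure
  simp only [Finset.mem_filter, Finset.mem_univ, true_and]

/-- `S ⊆ closure S`. [cite: BalabanImbrieJaffe1988, (2.44) p.264] -/
theorem subset_closure (cadj : κ → κ → Prop) (S : Finset κ) : S ⊆ closure cadj S :=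
  fun _ hc => mem_closure.mpr (Or.inl hc)

/-- the closure is monotone. [cite: BalabanImbrieJaffe1988, (2.44) p.264] -/
theorem closure_mono (cadj : κ → κ → Prop) {S T : Finset κ} (h : S ⊆ T) : closure cadj S ⊆ closure cadj T := by
  intro c hc
  rcases mem_closure.mp hc with hc | ⟨c', hc', hcc⟩
  · exact mem_closure.mpr (Or.inl (h hc))
  · exact mem_closure.mpr (Or.inr ⟨c', h hc', hcc⟩)

/-- membership in the interior. [cite: BalabanImbrieJaffe1988, (2.44) p.264] -/
theorem mem_interior {cadj : κ → κ → Prop} {X : Finset κ} {c : κ} :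
    c ∈ interior cadj X ↔ c ∈ X ∧ ∀ c', cadj c c' → c' ∈ X := by
  unfold interior
  simp only [Finset.mem_filter]

/-- *"which remain within X⁰ and which intersect each cube of X⁰"* with *"X⁰ … the cubes of X not at the boundary of X"*:
under reading R1 (`X⁰ = cubesMet ω`, `X = region ω`) the walk's cubes are exactly `X⁰`, and `X⁰` lies in the interior
of `X`. [cite: BalabanImbrieJaffe1988, (2.44) p.264] -/
theorem cubesMet_subset_interior (cubeOf : ι → κ) (cadj : κ → κ → Prop) (ω : Walk ι) :
    cubesMet cubeOf ω ⊆ interior cadj (region cubeOf cadj ω) := fun c hc =>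
  mem_interior.mpr ⟨subset_closure cadj _ hc, fun _ hcc' => mem_closure.mpr (Or.inr ⟨c, hc, hcc'⟩)⟩

/-- **(2.44)** p. 264 [PDF 8], verbatim: *"Let X be a connected union of r(e_k)-cubes, and let X⁰ be the cubes of X not
at the boundary of X. We define C^{(k)}_{Λ,X}(u; x₁, x₂) = Σ^X_ω C_ω(x₁, x₂), (2.44) where the sums runs over walks not
included in Σ′, which remain within X⁰ and which intersect each cube of X⁰."* — reading R1 (header): the sub-sum over
the walks NOT in `Σ′` whose cube region `region cubeOf cadj ω` (`= X⁰(ω) ∪` boundary layer) equals `X`; indexed by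
all `X : Finset κ` (zero unless `X` is such a region). [cite: BalabanImbrieJaffe1988, (2.44) p.264] -/
noncomputable def cX (ldist : ι → α → ℝ) (ρ : ℝ) (cubeOf : ι → κ) (cadj : κ → κ → Prop)
    (Cw : Walk ι → α → α → ℝ) (X : Finset κ) (x₁ x₂ : α) : ℝ :=
  ∑' ω, {ω : Walk ι | ¬ Near ldist ρ ω x₁ x₂ ∧ region cubeOf cadj ω = X}.indicator (fun ω => Cw ω x₁ x₂) ω

/-! ## §5 (2.45): the resummation identity, PROVED -/

/-- pointwise: every walk term is its local part plus the sum over `X` of its `X`-parts (exactly one class is hit).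
[cite: BalabanImbrieJaffe1988, (2.45) p.264] -/
theorem term_split (ldist : ι → α → ℝ) (ρ : ℝ) (cubeOf : ι → κ) (cadj : κ → κ → Prop)
    (f : Walk ι → ℝ) (x₁ x₂ : α) (ω : Walk ι) :
    f ω = {ω : Walk ι | Near ldist ρ ω x₁ x₂}.indicator f ω +
      ∑ X : Finset κ, {ω : Walk ι | ¬ Near ldist ρ ω x₁ x₂ ∧ region cubeOf cadj ω = X}.indicator f ω := by
  classical
  by_cases hn : Near ldist ρ ω x₁ x₂
  · rw [Set.indicator_of_mem (show ω ∈ {ω : Walk ι | Near ldist ρ ω x₁ x₂} from hn)]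
    rw [Finset.sum_eq_zero fun X _ => Set.indicator_of_notMem (fun h => h.1 hn) f, add_zero]
  · rw [Set.indicator_of_notMem (show ω ∉ {ω : Walk ι | Near ldist ρ ω x₁ x₂} from hn), zero_add]
    have hX : ∀ X : Finset κ,
        {ω : Walk ι | ¬ Near ldist ρ ω x₁ x₂ ∧ region cubeOf cadj ω = X}.indicator f ω =
          if region cubeOf cadj ω = X then f ω else 0 := fun X => by
      by_cases hX : region cubeOf cadj ω = X
      · rw [if_pos hX, Set.indicator_of_mem
          (show ω ∈ {ω : Walk ι | ¬ Near ldist ρ ω x₁ x₂ ∧ region cubeOf cadj ω = X} from ⟨hn, hX⟩)]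
      · rw [if_neg hX, Set.indicator_of_notMem
          (show ω ∉ {ω : Walk ι | ¬ Near ldist ρ ω x₁ x₂ ∧ region cubeOf cadj ω = X} from fun h => hX h.2)]
    simp only [hX, Finset.sum_ite_eq, Finset.mem_univ, if_true]

/-- **(2.45)** p. 264 [PDF 8], verbatim: *"Then we define C^{(k)}_Λ(u) = C^{(k)}_{Λ,loc}(u) + Σ_X C^{(k)}_{Λ,X}(u),
(2.45)"* — PROVED as typed (`BIJ88Sect2Statements.Eq245`, index type `Finset κ`) from the convergent expansion (2.42)
alone: the classes `Σ′`, `Σ^X` partition the walks and a summable real family may be summed fiberwise.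
[cite: BalabanImbrieJaffe1988, (2.45) p.264] -/
theorem eq245_of_eq242 (ldist : ι → α → ℝ) (ρ : ℝ) (cubeOf : ι → κ) (cadj : κ → κ → Prop)
    {C : α → α → ℝ} {Cw : Walk ι → α → α → ℝ} (h : Eq242 C Cw) :
    BIJ88Sect2Statements.Eq245 C (cLoc ldist ρ Cw) (cX ldist ρ cubeOf cadj Cw) := by
  intro x₁ x₂
  have hs : Summable fun ω => Cw ω x₁ x₂ := (h x₁ x₂).summable
  have hl : Summable ({ω : Walk ι | Near ldist ρ ω x₁ x₂}.indicator fun ω => Cw ω x₁ x₂) := hs.indicator _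
  have hX : ∀ X : Finset κ, Summable
      ({ω : Walk ι | ¬ Near ldist ρ ω x₁ x₂ ∧ region cubeOf cadj ω = X}.indicator fun ω => Cw ω x₁ x₂) :=
    fun X => hs.indicator _
  unfold cLoc cX
  rw [← (h x₁ x₂).tsum_eq, tsum_congr (term_split ldist ρ cubeOf cadj (fun ω => Cw ω x₁ x₂) x₁ x₂),
    hl.tsum_add (summable_sum fun X _ => hX X), Summable.tsum_finsetSum fun X _ => hX X]

/-! ## §6 (2.46), support clause: `C^{(k)}_{Λ,X}` vanishes unless both arguments are in `X` -/

/-- *"both arguments are in X"* for a site: `x` lies in a block `□_j` (`inBlock x j`) whose cube closure (the cube of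
`j` and its neighbours — the block `□_j` of side `2M` may straddle adjacent `r(e_k)`-cubes) is contained in `X`.
[cite: BalabanImbrieJaffe1988, (2.46) p.264] -/
def memX (inBlock : α → ι → Prop) (cubeOf : ι → κ) (cadj : κ → κ → Prop) (x : α) (X : Finset κ) : Prop :=
  ∃ j, inBlock x j ∧ closure cadj {cubeOf j} ⊆ X

/-- **(2.46)** p. 264 [PDF 8], support clause, verbatim: *"The operator C^{(k)}_{Λ,X}(u) depends only on u in X. It
vanishes unless both arguments are in X"* — PROVED from END-POINT LOCALITY of the walk terms (`hsupp`: `C_ω(x₁,x₂) ≠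
0 ⇒ x₁ ∈ □_{ω₀} ∧ x₂ ∈ □_{ω_n}`, the outer factors `h_{ω₀} … h_{ω_n}` of [6] (2.13)): this is the first conjunct of
`BIJ88Sect2Statements.Ineq246 ncubes (memX inBlock cubeOf cadj) (cX …) c rek`. [cite: BalabanImbrieJaffe1988, (2.46) p.264] -/
theorem cX_support (ldist : ι → α → ℝ) (ρ : ℝ) (cubeOf : ι → κ) (cadj : κ → κ → Prop)
    {Cw : Walk ι → α → α → ℝ} (inBlock : α → ι → Prop)
    (hsupp : ∀ ω x₁ x₂, Cw ω x₁ x₂ ≠ 0 → inBlock x₁ ω.start ∧ inBlock x₂ ω.last) :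
    ∀ X x₁ x₂, ¬ (memX inBlock cubeOf cadj x₁ X ∧ memX inBlock cubeOf cadj x₂ X) →
      cX ldist ρ cubeOf cadj Cw X x₁ x₂ = 0 := by
  intro X x₁ x₂ hX
  unfold cX
  rw [← tsum_zero (β := Walk ι)]
  refine tsum_congr fun ω => Set.indicator_apply_eq_zero.mpr fun hω => ?_
  by_contra hne
  obtain ⟨h1, h2⟩ := hsupp ω x₁ x₂ hne
  have hreg : ∀ {j}, j ∈ ω.pts → closure cadj {cubeOf j} ⊆ X := fun hj => by
    rw [← hω.2]
    exact closure_mono cadj (Finset.singleton_subset_iff.mpr (Finset.mem_image_of_mem cubeOf hj))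
  exact hX ⟨⟨ω.start, h1, hreg ω.start_mem_pts⟩, ⟨ω.last, h2, hreg ω.last_mem_pts⟩⟩

/-- knitting: support clause + the printed bound (a HYPOTHESIS here, not proved) = the typed row (2.46)
`BIJ88Sect2Statements.Ineq246` for these `C^{(k)}_{Λ,X}`, `|X| = X.card`. [cite: BalabanImbrieJaffe1988, (2.46) p.264] -/
theorem ineq246_of_bound (ldist : ι → α → ℝ) (ρ : ℝ) (cubeOf : ι → κ) (cadj : κ → κ → Prop)
    {Cw : Walk ι → α → α → ℝ} (inBlock : α → ι → Prop)
    (hsupp : ∀ ω x₁ x₂, Cw ω x₁ x₂ ≠ 0 → inBlock x₁ ω.start ∧ inBlock x₂ ω.last) (c rek : ℝ)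
    (hbound : ∀ X x₁ x₂, |cX ldist ρ cubeOf cadj Cw X x₁ x₂| ≤ Real.exp (-c * rek * (X.card : ℕ))) :
    BIJ88Sect2Statements.Ineq246 (fun X : Finset κ => X.card) (memX inBlock cubeOf cadj)
      (cX ldist ρ cubeOf cadj Cw) c rek :=
  ⟨cX_support ldist ρ cubeOf cadj inBlock hsupp, hbound⟩

end Regions

/-! ## §7 (2.42) PROVED *"as in [6]"*: locality and smallness give an unconditional sum over all walks -/

section B4Model

variable {R : Type*} [NormedRing R] [CompleteSpace R] {ι : Type*} [Fintype ι] [DecidableEq ι]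

/-- the path term of [6] (2.13)/(5.17): `a_{ω₀} b_{ω₁} ⋯ b_{ω_n}` (`a_j = h_jC_jh_j`, `b_j = K_jC_jh_j` resp. the
`R_{j,j′}C_{j′}h_{j′}` of [6] (5.14)). [cite: BalabanImbrieJaffe1988, (2.42) p.264] -/
def walkTerm (a b : ι → R) (ω : Walk ι) : R := a ω.start * bprod b ω.len ω.steps

/-- the same term read on the dependent pairs `(n, (ω₀, ys))`. [cite: BalabanImbrieJaffe1988, (2.42) p.264] -/
def sigTerm (a b : ι → R) (p : Σ n : ℕ, ι × (Fin n → ι)) : R := a p.2.1 * bprod b p.1 p.2.2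

omit [CompleteSpace R] in
/-- level-`n` absolute bound: `Σ_{(ω₀,ys)} ‖a_{ω₀} b_{ys}‖ ≤ |ι|·α·(Dβ)ⁿ` — non-walk tuples contribute `0` by locality,
at most `Dⁿ` walks from each start ([6] p. 579), each of norm `≤ αβⁿ`. [cite: BalabanImbrieJaffe1988, (2.42) p.264] -/
theorem level_norm_sum_le (adj : ι → ι → Prop) [DecidableRel adj] {a b : ι → R} {α β : ℝ} {D : ℕ}
    (hab : ∀ i l, ¬ adj i l → a i * b l = 0) (hbb : ∀ i l, ¬ adj i l → b i * b l = 0)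
    (hα : ∀ i, ‖a i‖ ≤ α) (hβ : ∀ i, ‖b i‖ ≤ β) (hβ0 : 0 ≤ β)
    (hD : ∀ j, (Finset.univ.filter fun i => adj j i).card ≤ D) (n : ℕ) :
    ∑ c : ι × (Fin n → ι), ‖sigTerm a b ⟨n, c⟩‖ ≤ (Fintype.card ι : ℝ) * α * ((D : ℝ) * β) ^ n := by
  have hi : ∀ i, ∑ ys : Fin n → ι, ‖a i * bprod b n ys‖ ≤ α * ((D : ℝ) * β) ^ n := by
    intro i
    have hα0 : 0 ≤ α := (norm_nonneg _).trans (hα i)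
    have hvan : ∀ ys ∈ (Finset.univ : Finset (Fin n → ι)), ys ∉ walks adj i n →
        ‖a i * bprod b n ys‖ = 0 := fun ys _ hys => by
      rw [mul_bprod_eq_zero_of_not_isWalk hbb n (fun l hl => hab i l hl) (mt mem_walks.mpr hys), norm_zero]
    calc ∑ ys : Fin n → ι, ‖a i * bprod b n ys‖
        = ∑ ys ∈ walks adj i n, ‖a i * bprod b n ys‖ := (Finset.sum_subset (Finset.subset_univ _) hvan).symm
      _ ≤ ∑ _ys ∈ walks adj i n, α * β ^ n := Finset.sum_le_sum fun ys _ =>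
          (norm_mul_bprod_le hβ n (a i) ys).trans (mul_le_mul_of_nonneg_right (hα i) (pow_nonneg hβ0 n))
      _ = (walks adj i n).card * (α * β ^ n) := by rw [Finset.sum_const, nsmul_eq_mul]
      _ ≤ (D : ℝ) ^ n * (α * β ^ n) :=
          mul_le_mul_of_nonneg_right (by exact_mod_cast card_walks_le adj hD n i)
            (mul_nonneg hα0 (pow_nonneg hβ0 n))
      _ = α * ((D : ℝ) * β) ^ n := by rw [mul_pow]; ring
  calc ∑ c : ι × (Fin n → ι), ‖sigTerm a b ⟨n, c⟩‖
      = ∑ i, ∑ ys : Fin n → ι, ‖a i * bprod b n ys‖ := Fintype.sum_prod_type _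
    _ ≤ ∑ _i : ι, α * ((D : ℝ) * β) ^ n := Finset.sum_le_sum fun i _ => hi i
    _ = (Fintype.card ι : ℝ) * α * ((D : ℝ) * β) ^ n := by
        rw [Finset.sum_const, nsmul_eq_mul, Finset.card_univ, mul_assoc]

/-- **(2.42) "as in [6]", PROVED.**  In a complete normed ring let `G₀ = Σ_j a_j`, `R = Σ_j b_j` with LOCAL factors
(`a_j b_{j′} = 0 = b_j b_{j′}` unless `j ~ j′`), `‖a_j‖ ≤ α`, `‖b_j‖ ≤ β`, at most `D` neighbours per label, `Dβ < 1`,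
`‖R‖ < 1` and `G(1 − R) = G₀` ([6] (2.12)). Then `G = Σ_ω a_{ω₀}b_{ω₁}⋯b_{ω_n}` over ALL walks as an unconditional
`HasSum` ([6] (2.13); the length-`n` layer sums to [6]'s `G₀Rⁿ`). [cite: BalabanImbrieJaffe1988, (2.42) p.264] -/
theorem hasSum_walkTerm (adj : ι → ι → Prop) [DecidableRel adj] {a b : ι → R} {G : R} {α β : ℝ} {D : ℕ}
    (hab : ∀ i l, ¬ adj i l → a i * b l = 0) (hbb : ∀ i l, ¬ adj i l → b i * b l = 0)
    (hα : ∀ i, ‖a i‖ ≤ α) (hβ : ∀ i, ‖b i‖ ≤ β)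
    (hD : ∀ j, (Finset.univ.filter fun i => adj j i).card ≤ D) (hDβ : (D : ℝ) * β < 1)
    (hR : ‖∑ i, b i‖ < 1) (hG : G * (1 - ∑ i, b i) = ∑ i, a i) :
    HasSum (walkTerm a b) G := by
  rcases isEmpty_or_nonempty ι with hι | hι
  · have hG0 : G = 0 := by simpa using hG
    haveI : IsEmpty (Walk ι) := ⟨fun ω => isEmptyElim ω.start⟩
    rw [hG0]
    exact hasSum_empty
  obtain ⟨i₀⟩ := hι
  have hβ0 : 0 ≤ β := (norm_nonneg _).trans (hβ i₀)
  have hα0 : 0 ≤ α := (norm_nonneg _).trans (hα i₀)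
  have hDβ0 : 0 ≤ (D : ℝ) * β := mul_nonneg D.cast_nonneg hβ0
  have hg : HasSum (fun n : ℕ => (∑ i, a i) * (∑ i, b i) ^ n) G := hasSum_of_norm_lt_one hR hG
  have hfib : ∀ n : ℕ, HasSum (fun c : ι × (Fin n → ι) => sigTerm a b ⟨n, c⟩) ((∑ i, a i) * (∑ i, b i) ^ n) := by
    intro n
    rw [order_term_eq_sum_tuples a b n, ← Fintype.sum_prod_type']
    exact hasSum_fintype _
  have hsf : Summable (sigTerm a b) := by
    refine Summable.of_norm ?_
    rw [summable_sigma_of_nonneg fun _ => norm_nonneg _]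
    refine ⟨fun n => (hasSum_fintype _).summable, ?_⟩
    refine Summable.of_nonneg_of_le (fun n => tsum_nonneg fun _ => norm_nonneg _) (fun n => ?_)
      ((summable_geometric_of_lt_one hDβ0 hDβ).mul_left ((Fintype.card ι : ℝ) * α))
    rw [tsum_fintype]
    exact level_norm_sum_le adj hab hbb hα hβ hβ0 hD n
  rw [show walkTerm a b = sigTerm a b ∘ Walk.equivSigma from rfl, Equiv.hasSum_iff]
  exact hg.sigma_of_hasSum hfib hsf

/-- **(2.42) entrywise from [6].**  Under the hypotheses of `hasSum_walkTerm`, for any family of continuous additive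
evaluations `ev x₁ x₂ : R →+ ℝ` (matrix entries of the operators of [6]) the kernels `C(x₁,x₂) = ev x₁ x₂ G` and
`C_ω(x₁,x₂) = ev x₁ x₂ (a_{ω₀}b_{ω₁}⋯b_{ω_n})` satisfy the typed (2.42). [cite: BalabanImbrieJaffe1988, (2.42) p.264] -/
theorem eq242_of_walkTerm {α' : Type*} (adj : ι → ι → Prop) [DecidableRel adj] {a b : ι → R} {G : R} {α β : ℝ}
    {D : ℕ} (hab : ∀ i l, ¬ adj i l → a i * b l = 0) (hbb : ∀ i l, ¬ adj i l → b i * b l = 0)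
    (hα : ∀ i, ‖a i‖ ≤ α) (hβ : ∀ i, ‖b i‖ ≤ β)
    (hD : ∀ j, (Finset.univ.filter fun i => adj j i).card ≤ D) (hDβ : (D : ℝ) * β < 1)
    (hR : ‖∑ i, b i‖ < 1) (hG : G * (1 - ∑ i, b i) = ∑ i, a i)
    (ev : α' → α' → R →+ ℝ) (hev : ∀ x₁ x₂, Continuous (ev x₁ x₂)) :
    Eq242 (fun x₁ x₂ => ev x₁ x₂ G) (fun ω x₁ x₂ => ev x₁ x₂ (walkTerm a b ω)) :=
  fun x₁ x₂ => (hasSum_walkTerm adj hab hbb hα hβ hD hDβ hR hG).map (ev x₁ x₂) (hev x₁ x₂)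

end B4Model


/-! ## §8 Only CONNECTED unions of cubes carry a part `C^{(k)}_{Λ,X}` (*"Let X be a connected union of r(e_k)-cubes"*) -/

section Connected

variable {ι κ : Type*} [DecidableEq ι] [Fintype κ] [DecidableEq κ]

omit [DecidableEq ι] [Fintype κ] in
/-- along a nearest-neighbour walk whose consecutive labels have equal or adjacent cubes (`hstep`), every cube of the
walk is reachable from the cube of the start inside any cube set containing the walk's cubes (induced cube graph,
adjacency symmetrized by `SimpleGraph.fromRel`). [cite: BalabanImbrieJaffe1988, (2.44) p.264] -/
theorem reachable_of_isWalk (cubeOf : ι → κ) (cadj : κ → κ → Prop) (adj : ι → ι → Prop)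
    (hstep : ∀ j j', adj j j' → cubeOf j = cubeOf j' ∨ cadj (cubeOf j) (cubeOf j') ∨ cadj (cubeOf j') (cubeOf j))
    (S : Set κ) :
    ∀ (n : ℕ) (j : ι) (ys : Fin n → ι), IsWalk adj j ys → ∀ (hj : cubeOf j ∈ S) (hys : ∀ k, cubeOf (ys k) ∈ S)
      (k : Fin n), ((SimpleGraph.fromRel cadj).induce S).Reachable ⟨cubeOf j, hj⟩ ⟨cubeOf (ys k), hys k⟩ := by
  intro n
  induction n with
  | zero => intro j ys _ hj hys k; exact k.elim0
  | succ n ih =>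
      intro j ys hw hj hys k
      rw [isWalk_succ] at hw
      have h0 : ((SimpleGraph.fromRel cadj).induce S).Reachable ⟨cubeOf j, hj⟩ ⟨cubeOf (ys 0), hys 0⟩ := by
        by_cases heq : cubeOf j = cubeOf (ys 0)
        · rw [show (⟨cubeOf j, hj⟩ : S) = ⟨cubeOf (ys 0), hys 0⟩ from Subtype.ext heq]
        · refine SimpleGraph.Adj.reachable ?_
          rw [SimpleGraph.induce_adj, SimpleGraph.fromRel_adj]
          exact ⟨heq, (hstep _ _ hw.1).resolve_left heq⟩
      refine Fin.cases ?_ (fun k' => ?_) k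
      · exact h0
      · exact h0.trans (ih (ys 0) (Fin.tail ys) hw.2 (hys 0) (fun k' => hys k'.succ) k')

/-- the cube region `X(ω)` of a nearest-neighbour walk is CONNECTED (as a union of `r(e_k)`-cubes: the cube graph
induced on it is connected) — the walk's cubes form a chain (`hstep`: adjacent labels have equal or adjacent cubes, as
`M ≤ r(e_k)`) and the boundary layer hangs on it. [cite: BalabanImbrieJaffe1988, (2.44) p.264] -/
theorem region_connected (cubeOf : ι → κ) (cadj : κ → κ → Prop) (adj : ι → ι → Prop)
    (hstep : ∀ j j', adj j j' → cubeOf j = cubeOf j' ∨ cadj (cubeOf j) (cubeOf j') ∨ cadj (cubeOf j') (cubeOf j))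
    (ω : Walk ι) (hω : ω.IsNN adj) :
    ((SimpleGraph.fromRel cadj).induce (↑(region cubeOf cadj ω) : Set κ)).Connected := by
  rw [SimpleGraph.connected_iff_exists_forall_reachable]
  have hS : ∀ j ∈ ω.pts, cubeOf j ∈ (↑(region cubeOf cadj ω) : Set κ) := fun j hj =>
    Finset.mem_coe.mpr (subset_closure cadj _ (Finset.mem_image_of_mem cubeOf hj))
  have hreach : ∀ (j) (hj : j ∈ ω.pts), ((SimpleGraph.fromRel cadj).induce (↑(region cubeOf cadj ω) : Set κ)).Reachable
      ⟨cubeOf ω.start, hS _ ω.start_mem_pts⟩ ⟨cubeOf j, hS j hj⟩ := by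
    intro j hj
    rcases Finset.mem_insert.mp hj with hj0 | hj'
    · subst hj0; rfl
    · obtain ⟨k, -, hk⟩ := Finset.mem_image.mp hj'
      subst hk
      exact reachable_of_isWalk cubeOf cadj adj hstep _ ω.len ω.start ω.steps hω (hS _ ω.start_mem_pts)
        (fun k => hS _ (ω.steps_mem_pts k)) k
  refine ⟨⟨cubeOf ω.start, hS _ ω.start_mem_pts⟩, fun c => ?_⟩
  obtain ⟨c, hc⟩ := c
  rcases mem_closure.mp (Finset.mem_coe.mp hc) with hcS | ⟨c', hc'S, hadj⟩
  · obtain ⟨j, hj, hjc⟩ := Finset.mem_image.mp hcS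
    subst hjc
    exact hreach j hj
  · obtain ⟨j, hj, hjc⟩ := Finset.mem_image.mp hc'S
    subst hjc
    by_cases heq : cubeOf j = c
    · subst heq; exact hreach j hj
    · refine (hreach j hj).trans (SimpleGraph.Adj.reachable ?_)
      rw [SimpleGraph.induce_adj, SimpleGraph.fromRel_adj]
      exact ⟨heq, Or.inl hadj⟩

variable {α : Type*}

/-- **(2.44)**, *"Let X be a connected union of r(e_k)-cubes"*: if the walk terms live on nearest-neighbour walks only
(`hNN`, the locality of [6] (2.13)) and adjacent labels have equal or adjacent cubes, then `C^{(k)}_{Λ,X}(x₁,x₂) ≠ 0`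
forces `X` to be connected — the typed sum over all `X : Finset κ` in (2.45) is the printed sum over connected `X`.
[cite: BalabanImbrieJaffe1988, (2.44) p.264] -/
theorem cX_ne_zero_connected (ldist : ι → α → ℝ) (ρ : ℝ) (cubeOf : ι → κ) (cadj : κ → κ → Prop)
    {Cw : Walk ι → α → α → ℝ} (adj : ι → ι → Prop)
    (hstep : ∀ j j', adj j j' → cubeOf j = cubeOf j' ∨ cadj (cubeOf j) (cubeOf j') ∨ cadj (cubeOf j') (cubeOf j))
    (hNN : ∀ ω x₁ x₂, Cw ω x₁ x₂ ≠ 0 → ω.IsNN adj) {X : Finset κ} {x₁ x₂ : α}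
    (h : cX ldist ρ cubeOf cadj Cw X x₁ x₂ ≠ 0) :
    ((SimpleGraph.fromRel cadj).induce (↑X : Set κ)).Connected := by
  have hex : ∃ ω : Walk ι,
      {ω : Walk ι | ¬ Near ldist ρ ω x₁ x₂ ∧ region cubeOf cadj ω = X}.indicator (fun ω => Cw ω x₁ x₂) ω ≠ 0 := by
    by_contra hall
    push Not at hall
    exact h ((tsum_congr hall).trans tsum_zero)
  obtain ⟨ω, hω⟩ := hex
  have hmem := Set.mem_of_indicator_ne_zero hω
  have hf : Cw ω x₁ x₂ ≠ 0 := by rwa [Set.indicator_of_mem hmem] at hω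
  rw [← hmem.2]
  exact region_connected cubeOf cadj adj hstep ω (hNN ω x₁ x₂ hf)

end Connected

end Literature.MathematicalPhysics.QuantumFieldTheory.BalabanImbrieJaffe1984to88.BIJ88RandomWalk242
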